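import Literature.NumberTheory.Automorphic.SmoothedAutomorphicForms
import Literature.NumberTheory.Automorphic.ArchUnipotentDilationGL2
import Mathlib.MeasureTheory.Integral.Prod
import HarnessLib

/-!
# Translation and archimedean unipotent convolution of smoothing weights

Topic `NumberTheory/Automorphic`; namespace `Literature.NumberTheory.Automorphic`. Proof file (one
definition with body, theorems). For the smoothed vectors `S_η f = ∫ η(g) R(g) f dg` of
`SmoothedAutomorphicForms` (`smoothedVector`, right regular representation `R` on
`L²(GL_n(K) A_G \ GL_n(𝔸_K))`, Haar measure `adelicHaar`) we PROVE the two operator identities behind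
the commutation calculus of the Kirillov `L²`-bound (Jacquet–Shalika (1981), §3–§4; the calculus of
`π(f)` on smooth vectors, Bump (1997), (2.28)):

* `coe_smoothedVector_leftTranslate` — **translation**: `R(h) S_η f = S_{L_h η} f` with the left
  translate `L_h η = η(h⁻¹ ·)` (`leftTranslateWeight`; substitution `g ↦ h g` in the Haar integral);
* `coe_smoothedVector_archUnipotentConv` — **convolution along the archimedean unipotent line of
  `GL_2`**: for a continuous compactly supported kernel `g₀` on `K_∞` and a continuous compactly
  supported weight `η`,
  `∫_{K_∞} g₀(x) R(n((x,0))) S_η f dx = S_{g₀ ⋆ η} f`, `(g₀ ⋆ η)(h) = ∫ g₀(x) η(n((x,0))⁻¹ h) dx`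
  (`archUnipotentConv`; Fubini for the Bochner integral on `K_∞ × GL_2(𝔸_K)`), together with the
  continuity and compact support of `g₀ ⋆ η` (`continuous_archUnipotentConv`,
  `hasCompactSupport_archUnipotentConv`).

## References

* H. Jacquet, J. A. Shalika, *On Euler products and the classification of automorphic
  representations I*, Amer. J. Math. 103 (1981), §3–§4 [JacquetShalikaAJM1981].
* D. Bump, *Automorphic Forms and Representations* (1997), §2.2, (2.28) [Bump1997].
-/

noncomputable section

open scoped MatrixGroups Classical
open NumberField NumberField.mixedEmbedding IsDedekindDomain MeasureTheory Complex

namespace Literature.NumberTheory.Automorphic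

variable {n : ℕ} {K : Type} [Field K] [NumberField K]
  {μ : Measure (AdelicGroupData.gl n K).automorphicQuotient} [(AdelicGroupData.gl n K).IsAutomorphicMeasure μ]

attribute [local instance] adelicBorel borelSpace_adelic locallyCompactSpace_adelic
  secondCountableTopology_gl_adelic

/-! ### Left translates of weights -/

/-- The **left translate** `L_h η = η(h⁻¹ ·)` of a weight. [folklore] -/
def leftTranslateWeight (h : (AdelicGroupData.gl n K).Adelic) (η : (AdelicGroupData.gl n K).Adelic → ℝ) :
    (AdelicGroupData.gl n K).Adelic → ℝ :=
  fun g => η (h⁻¹ * g)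

/-- Unfolding of `leftTranslateWeight`. [folklore] -/
@[simp]
theorem leftTranslateWeight_apply (h : (AdelicGroupData.gl n K).Adelic) (η : (AdelicGroupData.gl n K).Adelic → ℝ)
    (g : (AdelicGroupData.gl n K).Adelic) : leftTranslateWeight h η g = η (h⁻¹ * g) := rfl

/-- `L_1 η = η`. [folklore] -/
@[simp]
theorem leftTranslateWeight_one (η : (AdelicGroupData.gl n K).Adelic → ℝ) : leftTranslateWeight 1 η = η := by
  funext g; simp only [leftTranslateWeight, inv_one, one_mul]

/-- `L_{h h'} η = L_h (L_{h'} η)`. [folklore] -/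
theorem leftTranslateWeight_mul (h h' : (AdelicGroupData.gl n K).Adelic) (η : (AdelicGroupData.gl n K).Adelic → ℝ) :
    leftTranslateWeight (h * h') η = leftTranslateWeight h (leftTranslateWeight h' η) := by
  funext g; simp only [leftTranslateWeight, mul_inv_rev, mul_assoc]

/-- A left translate of a continuous weight is continuous. [folklore] -/
theorem continuous_leftTranslateWeight {η : (AdelicGroupData.gl n K).Adelic → ℝ} (hη : Continuous η)
    (h : (AdelicGroupData.gl n K).Adelic) : Continuous (leftTranslateWeight h η) :=
  hη.comp (continuous_const.mul continuous_id)

/-- A left translate of a compactly supported weight is compactly supported. [folklore] -/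
theorem hasCompactSupport_leftTranslateWeight {η : (AdelicGroupData.gl n K).Adelic → ℝ}
    (hηs : HasCompactSupport η) (h : (AdelicGroupData.gl n K).Adelic) :
    HasCompactSupport (leftTranslateWeight h η) := by
  have : leftTranslateWeight h η = η ∘ (Homeomorph.mulLeft h⁻¹) := by
    funext g; rfl
  rw [this]
  exact hηs.comp_homeomorph _

/-- Left translation preserves left invariance under a subgroup commuting past `h`… in the form
needed: if `η` is left `U`-invariant and `h` commutes with every element of `U`, so is `L_h η`.
[folklore] -/
theorem leftTranslateWeight_left_invariant {η : (AdelicGroupData.gl n K).Adelic → ℝ}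
    {U : Set (AdelicGroupData.gl n K).Adelic} (hηU : ∀ u ∈ U, ∀ g, η (u * g) = η g)
    (h : (AdelicGroupData.gl n K).Adelic) (hcomm : ∀ u ∈ U, h * u = u * h) (u : (AdelicGroupData.gl n K).Adelic)
    (hu : u ∈ U) (g : (AdelicGroupData.gl n K).Adelic) :
    leftTranslateWeight h η (u * g) = leftTranslateWeight h η g := by
  simp only [leftTranslateWeight_apply]
  have hc : h⁻¹ * u = u * h⁻¹ := by
    rw [eq_mul_inv_iff_mul_eq, mul_assoc, ← hcomm u hu, ← mul_assoc, inv_mul_cancel, one_mul]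
  rw [← mul_assoc, hc, mul_assoc, hηU u hu]

/-- Right invariance is preserved by left translation. [folklore] -/
theorem leftTranslateWeight_right_invariant {η : (AdelicGroupData.gl n K).Adelic → ℝ}
    {U : Set (AdelicGroupData.gl n K).Adelic} (hηU : ∀ u ∈ U, ∀ g, η (g * u) = η g)
    (h u : (AdelicGroupData.gl n K).Adelic) (hu : u ∈ U) (g : (AdelicGroupData.gl n K).Adelic) :
    leftTranslateWeight h η (g * u) = leftTranslateWeight h η g := by
  simp only [leftTranslateWeight_apply, ← mul_assoc, hηU u hu]

/-- The `L²`-valued integrand `η(g) • R(g) F` of a smoothed vector is Bochner integrable for a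
continuous compactly supported weight (a private copy of the lemma of the same name in
`AutomorphicGLnMultiplicityOneProofs`, to keep the import closure small). [folklore] -/
private theorem integrable_smul_rightRegular' {η : (AdelicGroupData.gl n K).Adelic → ℝ} (hη : Continuous η)
    (hηs : HasCompactSupport η) (F : (AdelicGroupData.gl n K).L2 μ) :
    Integrable (fun g => (η g : ℂ) • (AdelicGroupData.gl n K).rightRegular μ g F) (adelicHaar n K) := by
  refine Continuous.integrable_of_hasCompactSupport ?_ ?_
  · exact (Complex.continuous_ofReal.comp hη).smul
      ((AdelicGroupData.isStronglyContinuous_rightRegular_holds (AdelicGroupData.gl n K) μ) F)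
  · exact (hηs.comp_left Complex.ofReal_zero).smul_right

variable (W : ContRepresentation.ClosedSubrep ((AdelicGroupData.gl n K).rightRegular μ))

/-- **Translation of smoothed vectors**: `R(h) S_η f = S_{L_h η} f` in `L²` (substitute `g ↦ h g` in
the Haar integral). [cite: Bump1997, (2.28) (PDF p. 279)] -/
theorem coe_smoothedVector_leftTranslate {η : (AdelicGroupData.gl n K).Adelic → ℝ} (hη : Continuous η)
    (hηs : HasCompactSupport η) (f : W.toSubmodule) (h : (AdelicGroupData.gl n K).Adelic) :
    (smoothedVector W (leftTranslateWeight h η) f : (AdelicGroupData.gl n K).L2 μ) =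
      (AdelicGroupData.gl n K).rightRegular μ h (smoothedVector W η f : (AdelicGroupData.gl n K).L2 μ) := by
  rw [coe_smoothedVector W (continuous_leftTranslateWeight hη h) (hasCompactSupport_leftTranslateWeight hηs h) f,
    coe_smoothedVector W hη hηs f,
    ← ContinuousLinearMap.integral_comp_comm ((AdelicGroupData.gl n K).rightRegular μ h)
      (integrable_smul_rightRegular' hη hηs (f : (AdelicGroupData.gl n K).L2 μ))]
  have h1 : (fun g => (AdelicGroupData.gl n K).rightRegular μ h
      ((η g : ℂ) • (AdelicGroupData.gl n K).rightRegular μ g (f : (AdelicGroupData.gl n K).L2 μ))) =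
      fun g => (η g : ℂ) • (AdelicGroupData.gl n K).rightRegular μ (h * g) (f : (AdelicGroupData.gl n K).L2 μ) := by
    funext g
    rw [ContinuousLinearMap.map_smul, map_mul]
    rfl
  rw [h1, ← integral_mul_left_eq_self (μ := adelicHaar n K)
    (fun g => (leftTranslateWeight h η g : ℂ) •
      (AdelicGroupData.gl n K).rightRegular μ g (f : (AdelicGroupData.gl n K).L2 μ)) h]
  refine integral_congr_ae (ae_of_all _ fun g => ?_)
  simp only [leftTranslateWeight_apply, inv_mul_cancel_left]

/-! ### Convolution along the archimedean unipotent line of `GL_2` -/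

section GL2

variable {μ₂ : Measure (AdelicGroupData.gl 2 K).automorphicQuotient} [(AdelicGroupData.gl 2 K).IsAutomorphicMeasure μ₂]

/-- **The archimedean unipotent convolution** of a weight on `GL_2(𝔸_K)` by a kernel `g₀` on
`K_∞`: `(g₀ ⋆ η)(h) = ∫_{K_∞} g₀(x) η(n((x,0))⁻¹ h) dx`. [cite: JacquetShalikaAJM1981, §4] -/
def archUnipotentConv (g₀ : mixedSpace K → ℝ) (η : (AdelicGroupData.gl 2 K).Adelic → ℝ) :
    (AdelicGroupData.gl 2 K).Adelic → ℝ :=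
  fun h => ∫ x, g₀ x * η ((archUnipotentAdelic K x)⁻¹ * h)

/-- Unfolding of `archUnipotentConv`. [folklore] -/
theorem archUnipotentConv_apply (g₀ : mixedSpace K → ℝ) (η : (AdelicGroupData.gl 2 K).Adelic → ℝ)
    (h : (AdelicGroupData.gl 2 K).Adelic) :
    archUnipotentConv g₀ η h = ∫ x, g₀ x * leftTranslateWeight (archUnipotentAdelic K x) η h := by
  rfl

/-- The joint kernel `(x, h) ↦ g₀(x) η(n((x,0))⁻¹ h)` is continuous. [folklore] -/
theorem continuous_archUnipotentConv_kernel {g₀ : mixedSpace K → ℝ} (hg₀ : Continuous g₀)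
    {η : (AdelicGroupData.gl 2 K).Adelic → ℝ} (hη : Continuous η) :
    Continuous fun p : mixedSpace K × (AdelicGroupData.gl 2 K).Adelic =>
      g₀ p.1 * η ((archUnipotentAdelic K p.1)⁻¹ * p.2) :=
  (hg₀.comp continuous_fst).mul (hη.comp
    (((continuous_archUnipotentAdelic.comp continuous_fst).inv).mul continuous_snd))

/-- The joint kernel has compact support (contained in `supp g₀ × n(supp g₀) · supp η`). [folklore] -/
theorem hasCompactSupport_archUnipotentConv_kernel {g₀ : mixedSpace K → ℝ} (hg₀s : HasCompactSupport g₀)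
    {η : (AdelicGroupData.gl 2 K).Adelic → ℝ} (hηs : HasCompactSupport η) :
    HasCompactSupport fun p : mixedSpace K × (AdelicGroupData.gl 2 K).Adelic =>
      g₀ p.1 * η ((archUnipotentAdelic K p.1)⁻¹ * p.2) := by
  -- the support lies in `tsupport g₀ × ((n ∘ val) '' tsupport g₀) * tsupport η`
  set A : Set (mixedSpace K) := tsupport g₀ with hA
  set B : Set (AdelicGroupData.gl 2 K).Adelic :=
    (fun p : mixedSpace K × (AdelicGroupData.gl 2 K).Adelic => archUnipotentAdelic K p.1 * p.2) '' (A ×ˢ tsupport η)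
    with hB
  have hAc : IsCompact A := hg₀s
  have hBc : IsCompact B := (hAc.prod hηs).image
    ((continuous_archUnipotentAdelic.comp continuous_fst).mul continuous_snd)
  refine HasCompactSupport.of_support_subset_isCompact (hAc.prod hBc) fun p hp => ?_
  rw [Function.mem_support, mul_ne_zero_iff] at hp
  refine ⟨subset_tsupport _ hp.1, ?_⟩
  refine ⟨(p.1, (archUnipotentAdelic K p.1)⁻¹ * p.2), ⟨subset_tsupport _ hp.1, subset_tsupport _ hp.2⟩, ?_⟩
  simp only [mul_inv_cancel_left]

/-- **`g₀ ⋆ η` is continuous** for continuous compactly supported `g₀`, `η`. [folklore] -/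
theorem continuous_archUnipotentConv {g₀ : mixedSpace K → ℝ} (hg₀ : Continuous g₀) (hg₀s : HasCompactSupport g₀)
    {η : (AdelicGroupData.gl 2 K).Adelic → ℝ} (hη : Continuous η) (hηs : HasCompactSupport η) :
    Continuous (archUnipotentConv g₀ η) := by
  have hk := continuous_archUnipotentConv_kernel hg₀ hη
  have hks := hasCompactSupport_archUnipotentConv_kernel (K := K) hg₀s hηs
  -- continuity of a parametric integral with jointly continuous, compactly supported integrand
  have hk' : Continuous (Function.uncurry fun (h : (AdelicGroupData.gl 2 K).Adelic) (x : mixedSpace K) =>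
      g₀ x * η ((archUnipotentAdelic K x)⁻¹ * h)) :=
    hk.comp (continuous_snd.prodMk continuous_fst)
  have hks' : HasCompactSupport (Function.uncurry fun (h : (AdelicGroupData.gl 2 K).Adelic) (x : mixedSpace K) =>
      g₀ x * η ((archUnipotentAdelic K x)⁻¹ * h)) := by
    have : (Function.uncurry fun (h : (AdelicGroupData.gl 2 K).Adelic) (x : mixedSpace K) =>
        g₀ x * η ((archUnipotentAdelic K x)⁻¹ * h)) =
        (fun p : mixedSpace K × (AdelicGroupData.gl 2 K).Adelic => g₀ p.1 * η ((archUnipotentAdelic K p.1)⁻¹ * p.2)) ∘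
          (Homeomorph.prodComm ((AdelicGroupData.gl 2 K).Adelic) (mixedSpace K)) := by
      funext p; rfl
    rw [this]
    exact hks.comp_homeomorph _
  have hcont := continuous_parametric_integral_of_continuous (μ := (volume : Measure (mixedSpace K))) hk' hg₀s
  refine hcont.congr fun h => ?_
  refine setIntegral_eq_integral_of_forall_compl_eq_zero fun x hx => ?_
  rw [image_eq_zero_of_notMem_tsupport hx, zero_mul]

/-- **`g₀ ⋆ η` has compact support** (`⊆ n(supp g₀) · supp η`). [folklore] -/
theorem hasCompactSupport_archUnipotentConv {g₀ : mixedSpace K → ℝ} (hg₀s : HasCompactSupport g₀)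
    {η : (AdelicGroupData.gl 2 K).Adelic → ℝ} (hηs : HasCompactSupport η) :
    HasCompactSupport (archUnipotentConv g₀ η) := by
  set B : Set (AdelicGroupData.gl 2 K).Adelic :=
    (fun p : mixedSpace K × (AdelicGroupData.gl 2 K).Adelic => archUnipotentAdelic K p.1 * p.2) ''
      (tsupport g₀ ×ˢ tsupport η) with hB
  have hBc : IsCompact B := (hg₀s.prod hηs).image
    ((continuous_archUnipotentAdelic.comp continuous_fst).mul continuous_snd)
  refine HasCompactSupport.of_support_subset_isCompact hBc fun h hh => ?_
  rw [Function.mem_support] at hh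
  by_contra hnot
  apply hh
  refine integral_eq_zero_of_ae (ae_of_all _ fun x => ?_)
  by_cases hx : x ∈ tsupport g₀
  · have hη0 : η ((archUnipotentAdelic K x)⁻¹ * h) = 0 := by
      by_contra hne
      exact hnot ⟨(x, (archUnipotentAdelic K x)⁻¹ * h), ⟨hx, subset_tsupport _ hne⟩, mul_inv_cancel_left _ _⟩
    show g₀ x * η ((archUnipotentAdelic K x)⁻¹ * h) = 0
    rw [hη0, mul_zero]
  · show g₀ x * η ((archUnipotentAdelic K x)⁻¹ * h) = 0
    rw [image_eq_zero_of_notMem_tsupport hx, zero_mul]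

/-- **Convolution of smoothed vectors along the unipotent line**: for continuous compactly supported
`g₀` on `K_∞` and `η` on `GL_2(𝔸_K)`,
`∫_{K_∞} g₀(x) R(n((x,0))) S_η f dx = S_{g₀ ⋆ η} f` in `L²` (translation identity and Fubini on
`K_∞ × GL_2(𝔸_K)`). [cite: JacquetShalikaAJM1981, §4] -/
theorem coe_smoothedVector_archUnipotentConv
    (W₂ : ContRepresentation.ClosedSubrep ((AdelicGroupData.gl 2 K).rightRegular μ₂))
    {g₀ : mixedSpace K → ℝ} (hg₀ : Continuous g₀) (hg₀s : HasCompactSupport g₀)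
    {η : (AdelicGroupData.gl 2 K).Adelic → ℝ} (hη : Continuous η) (hηs : HasCompactSupport η)
    (f : W₂.toSubmodule) :
    (smoothedVector W₂ (archUnipotentConv g₀ η) f : (AdelicGroupData.gl 2 K).L2 μ₂) =
      ∫ x, (g₀ x : ℂ) • (AdelicGroupData.gl 2 K).rightRegular μ₂ (archUnipotentAdelic K x)
        (smoothedVector W₂ η f : (AdelicGroupData.gl 2 K).L2 μ₂) := by
  -- the joint integrand on `K_∞ × GL_2(𝔸)`
  set Φ : mixedSpace K × (AdelicGroupData.gl 2 K).Adelic → (AdelicGroupData.gl 2 K).L2 μ₂ :=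
    fun p => ((g₀ p.1 * η ((archUnipotentAdelic K p.1)⁻¹ * p.2) : ℝ) : ℂ) •
      (AdelicGroupData.gl 2 K).rightRegular μ₂ p.2 (f : (AdelicGroupData.gl 2 K).L2 μ₂) with hΦ
  have hΦc : Continuous Φ :=
    (Complex.continuous_ofReal.comp (continuous_archUnipotentConv_kernel hg₀ hη)).smul
      (((AdelicGroupData.isStronglyContinuous_rightRegular_holds (AdelicGroupData.gl 2 K) μ₂)
        (f : (AdelicGroupData.gl 2 K).L2 μ₂)).comp continuous_snd)
  have hΦs : HasCompactSupport Φ :=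
    ((hasCompactSupport_archUnipotentConv_kernel (K := K) hg₀s hηs).comp_left Complex.ofReal_zero).smul_right
  have hΦi : Integrable Φ ((volume : Measure (mixedSpace K)).prod (adelicHaar 2 K)) :=
    hΦc.integrable_of_hasCompactSupport hΦs
  -- right-hand side: `∫_x ∫_g Φ`
  have hrhs : ∀ x, (g₀ x : ℂ) • (AdelicGroupData.gl 2 K).rightRegular μ₂ (archUnipotentAdelic K x)
      (smoothedVector W₂ η f : (AdelicGroupData.gl 2 K).L2 μ₂) = ∫ g, Φ (x, g) ∂(adelicHaar 2 K) := by
    intro x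
    rw [← coe_smoothedVector_leftTranslate W₂ hη hηs f (archUnipotentAdelic K x),
      coe_smoothedVector W₂ (continuous_leftTranslateWeight hη _) (hasCompactSupport_leftTranslateWeight hηs _) f,
      ← integral_smul]
    refine integral_congr_ae (ae_of_all _ fun g => ?_)
    simp only [hΦ, leftTranslateWeight_apply, Complex.ofReal_mul, smul_smul]
  simp_rw [hrhs]
  rw [integral_integral_swap hΦi]
  -- left-hand side: `∫_g (∫_x kernel) • R g F`
  rw [coe_smoothedVector W₂ (continuous_archUnipotentConv hg₀ hg₀s hη hηs)
    (hasCompactSupport_archUnipotentConv hg₀s hηs) f]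
  refine integral_congr_ae (ae_of_all _ fun g => ?_)
  simp only [hΦ]
  rw [integral_smul_const, archUnipotentConv]
  congr 1
  rw [← integral_complex_ofReal]

end GL2

end Literature.NumberTheory.Automorphic
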